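import Literature.Probability.RandomPlanarGeometry.ChordalRestrictionMarkov
import HarnessLib

/-!
# `stub_markovOfLimit` (line `split`, crux stmt-CriticalPhenomena-1370): the shape reduction of the kernel

Evidence file of the lead (prover-line-stmt-CriticalPhenomena-1370-c1-0), kernel-checked, NOT a Theorems
file (it proves no registered stub): the restriction-coupled domain Markov property
`ChordalFamily.IsRestrictionMarkov P` (= the conclusion of `stub_markovOfLimit` / of the split child
`MarkovOfLimit`, `isRestrictionMarkov_iff = Iff.rfl`) is EQUIVALENT to the existence of a kernel of the
shape `Φ (remainingDomain D p) p.target (D.pt 1)` — a function of the remaining slit domain, the tip and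
the target only — satisfying the `initial`, `markov` and restriction-kernel clauses. In this form the
`domain` clause of `IsMarkovExtension` is AUTOMATIC (it is `congrArg`), so any construction of the kernel
may (and must) be organised as a function of the marked slit domain `(R; t, b)`; the content of the stub
is entirely in the disintegration clause `markov` (plus `initial` = `(lim)` + uniqueness, and the kernel
clause, which holds by construction for kernels generated by restriction and is `0 = 0` wherever
`Φ (R; t, b) = 0`, e.g. off the configurations charged by `P`).

`isRestrictionMarkov_iff_shape` : `P.IsRestrictionMarkov ↔ ∃ Φ, initial' ∧ markov' ∧ kernel'`.
-/

noncomputable section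

open Set MeasureTheory Topology Filter
open scoped unitInterval ENNReal

namespace Literature.Probability.RandomPlanarGeometry.ChordalFamily

variable {P : ChordalFamily}

/-- The tip of the trivial past (the constant curve at `a`) is `a`. [folklore] -/
theorem target_mk_const (x : ℂ) : (CurveClass.mk (Curve.const x)).target = x := by
  simp [Curve.target_def]

/-- **Kernels of slit-domain shape give the restriction-coupled Markov property.** If
`Φ : Set ℂ → ℂ → ℂ → Measure (CurveClass ℂ)` (law of the future in the marked slit domain `(R; t, b)`)
satisfies (initial') `Φ D a b = P D`, (markov') the disintegration of every `P D` at the first hitting of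
every closed set through `Φ (remainingDomain D past; tip, b)`, and (kernel') the restriction-kernel
clause, then `Q D p := Φ (remainingDomain D p) p.target (D.pt 1)` witnesses `P.IsRestrictionMarkov`;
the `domain` clause holds by `congrArg`. [folklore] -/
theorem isRestrictionMarkov_of_shape (Φ : Set ℂ → ℂ → ℂ → Measure (CurveClass ℂ))
    (h0 : ∀ D : DobrushinDomain, Φ D.carrier (D.pt 0) (D.pt 1) = P D)
    (hmk : ∀ (D : DobrushinDomain) (F : Set ℂ), IsClosed F →
      ∀ S T : Set (CurveClass ℂ), MeasurableSet S → MeasurableSet T →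
        P D (CurveClass.stopAt F ⁻¹' S ∩ CurveClass.startFrom F ⁻¹' T) =
          ∫⁻ γ in CurveClass.stopAt F ⁻¹' S,
            Φ (remainingDomain D (γ.stopAt F)) (γ.stopAt F).target (D.pt 1) T ∂(P D))
    (hK : ∀ (D : DobrushinDomain) (p : CurveClass ℂ) (D' : DobrushinDomain),
      D'.carrier ⊆ remainingDomain D p → D'.pt 0 = p.target → D'.pt 1 = D.pt 1 →
        ∀ T : Set (CurveClass ℂ), MeasurableSet T →
          P D' T * Φ (remainingDomain D p) p.target (D.pt 1)
              (CurveClass.rangeSubset (closure D'.carrier)) =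
            Φ (remainingDomain D p) p.target (D.pt 1)
              (T ∩ CurveClass.rangeSubset (closure D'.carrier))) :
    P.IsRestrictionMarkov := by
  refine ⟨fun D p => Φ (remainingDomain D p) p.target (D.pt 1), ⟨?_, ?_, ?_⟩, ?_⟩
  · intro D
    rw [remainingDomain_mk_const, target_mk_const, h0]
  · intro D F hF S T hS hT
    exact hmk D F hF S T hS hT
  · intro D₁ D₂ p₁ p₂ hR ht hb
    simp only [hR, ht, hb]
  · intro D p D' hsub h0' h1 T hT
    exact hK D p D' hsub h0' h1 T hT

/-- **Conversely, every restriction-coupled Markov kernel has slit-domain shape**: by the `domain`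
clause `Q D p` is a function of `(remainingDomain D p, p.target, D.pt 1)`; choosing a preimage (and the
zero measure off the image) produces `Φ` with the three clauses. [folklore] -/
theorem shape_of_isRestrictionMarkov (h : P.IsRestrictionMarkov) :
    ∃ Φ : Set ℂ → ℂ → ℂ → Measure (CurveClass ℂ),
      (∀ D : DobrushinDomain, Φ D.carrier (D.pt 0) (D.pt 1) = P D) ∧
      (∀ (D : DobrushinDomain) (F : Set ℂ), IsClosed F →
        ∀ S T : Set (CurveClass ℂ), MeasurableSet S → MeasurableSet T →
          P D (CurveClass.stopAt F ⁻¹' S ∩ CurveClass.startFrom F ⁻¹' T) =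
            ∫⁻ γ in CurveClass.stopAt F ⁻¹' S,
              Φ (remainingDomain D (γ.stopAt F)) (γ.stopAt F).target (D.pt 1) T ∂(P D)) ∧
      (∀ (D : DobrushinDomain) (p : CurveClass ℂ) (D' : DobrushinDomain),
        D'.carrier ⊆ remainingDomain D p → D'.pt 0 = p.target → D'.pt 1 = D.pt 1 →
          ∀ T : Set (CurveClass ℂ), MeasurableSet T →
            P D' T * Φ (remainingDomain D p) p.target (D.pt 1)
                (CurveClass.rangeSubset (closure D'.carrier)) =
              Φ (remainingDomain D p) p.target (D.pt 1)
                (T ∩ CurveClass.rangeSubset (closure D'.carrier))) := by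
  classical
  obtain ⟨Q, hQ, hK⟩ := h
  -- the kernel as a function of the marked slit domain `(R; t, b)` (zero off the image)
  let Φ : Set ℂ → ℂ → ℂ → Measure (CurveClass ℂ) := fun R t b =>
    if hx : ∃ Dp : DobrushinDomain × CurveClass ℂ,
        remainingDomain Dp.1 Dp.2 = R ∧ Dp.2.target = t ∧ Dp.1.pt 1 = b
    then Q hx.choose.1 hx.choose.2 else 0
  have hΦ : ∀ (D : DobrushinDomain) (p : CurveClass ℂ),
      Φ (remainingDomain D p) p.target (D.pt 1) = Q D p := by
    intro D p
    have hx : ∃ Dp : DobrushinDomain × CurveClass ℂ,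
        remainingDomain Dp.1 Dp.2 = remainingDomain D p ∧ Dp.2.target = p.target ∧
          Dp.1.pt 1 = D.pt 1 := ⟨(D, p), rfl, rfl, rfl⟩
    simp only [Φ, dif_pos hx]
    obtain ⟨h1, h2, h3⟩ := hx.choose_spec
    exact hQ.domain _ _ _ _ h1 h2 h3
  refine ⟨Φ, ?_, ?_, ?_⟩
  · intro D
    have := hΦ D (CurveClass.mk (Curve.const (D.pt 0)))
    rw [remainingDomain_mk_const, target_mk_const] at this
    rw [this, hQ.initial]
  · intro D F hF S T hS hT
    simp only [hΦ]
    exact hQ.markov D F hF S T hS hT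
  · intro D p D' hsub h0 h1 T hT
    simp only [hΦ]
    exact hK D p D' hsub h0 h1 T hT

/-- **Shape reduction (equivalence).** `P.IsRestrictionMarkov` iff there is a kernel of the marked
slit domain `Φ (R; t, b)` with the `initial`, `markov` and restriction-kernel clauses; the `domain`
clause of `IsMarkovExtension` carries no content beyond this shape. [folklore] -/
theorem isRestrictionMarkov_iff_shape :
    P.IsRestrictionMarkov ↔ ∃ Φ : Set ℂ → ℂ → ℂ → Measure (CurveClass ℂ),
      (∀ D : DobrushinDomain, Φ D.carrier (D.pt 0) (D.pt 1) = P D) ∧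
      (∀ (D : DobrushinDomain) (F : Set ℂ), IsClosed F →
        ∀ S T : Set (CurveClass ℂ), MeasurableSet S → MeasurableSet T →
          P D (CurveClass.stopAt F ⁻¹' S ∩ CurveClass.startFrom F ⁻¹' T) =
            ∫⁻ γ in CurveClass.stopAt F ⁻¹' S,
              Φ (remainingDomain D (γ.stopAt F)) (γ.stopAt F).target (D.pt 1) T ∂(P D)) ∧
      (∀ (D : DobrushinDomain) (p : CurveClass ℂ) (D' : DobrushinDomain),
        D'.carrier ⊆ remainingDomain D p → D'.pt 0 = p.target → D'.pt 1 = D.pt 1 →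
          ∀ T : Set (CurveClass ℂ), MeasurableSet T →
            P D' T * Φ (remainingDomain D p) p.target (D.pt 1)
                (CurveClass.rangeSubset (closure D'.carrier)) =
              Φ (remainingDomain D p) p.target (D.pt 1)
                (T ∩ CurveClass.rangeSubset (closure D'.carrier))) :=
  ⟨shape_of_isRestrictionMarkov, fun ⟨Φ, h0, hmk, hK⟩ => isRestrictionMarkov_of_shape Φ h0 hmk hK⟩

/-- **The kernel clause is free wherever the kernel vanishes**: if `Φ (R; t, b) = 0` the
restriction-kernel identity at that configuration is `0 = 0` — so a kernel only has to be specified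
(and tied to `P`) on the configurations one cares about (e.g. the remaining domains of `P`-typical
stopped pasts), with the zero measure elsewhere. [folklore] -/
theorem kernelClause_of_eq_zero {Q : DobrushinDomain → CurveClass ℂ → Measure (CurveClass ℂ)}
    {D : DobrushinDomain} {p : CurveClass ℂ} (hQ : Q D p = 0) (D' : DobrushinDomain)
    (T : Set (CurveClass ℂ)) :
    P D' T * Q D p (CurveClass.rangeSubset (closure D'.carrier)) =
      Q D p (T ∩ CurveClass.rangeSubset (closure D'.carrier)) := by
  simp [hQ]

end Literature.Probability.RandomPlanarGeometry.ChordalFamily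

end
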